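import Summits.Ventures.CertifiedManyBodySolver.Downfold.EmeryFermiFillingCount
import Summits.Ventures.CertifiedManyBodySolver.Downfold.EmeryFermiSurfaceRatioWindow
import HarnessLib

/-!
# The filling ↦ Fermi-energy map of the σ three-band antibonding band, III: the sub-box rule (bracket +
# corner window from five kernel checks) and the certified `K = 24` momentum grid table

Venture CertifiedManyBodySolver, cell `pub/hubbard-downfold` (stage S1), seat hubbard-downfold-mod-4 (technique
B); namespace `Summit.Ventures.CertifiedManyBodySolver.Downfold.Emery`. Everything here is PROVED. WHAT THIS IS
NOT: a statement about any material; no literature number lives here (the grid table is pure trigonometry,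
certified against the engine by `gridEncl24`).

* `subBoxCheck` — the rational side conditions of one parameter SUB-BOX `[Δ₁, Δ₂] × [a₁, a₂] × [b₁, b₂] ×
  [c₁, c₂]` with Fermi-energy bracket candidates `e₁ ≤ e₂` and coefficient bounds `Ahi, Dlo, Nlo` (at `e₁`)
  / `Alo, Dhi, Nhi` (at `e₂`) for `EmeryFermiFillingCount`; `fsRatio_window_of_checks` — THE SUB-BOX RULE:
  `subBoxCheck`, an outer count `< ν₁` at `e₁`, an inner count `> ν₂` at `e₂`, and two `ratioCheck`s at the
  opposite corners give `t′/t ∈ [lo, hi]` at every point of the sub-box and every Fermi energy whose filling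
  lies in `[ν₁, ν₂]`. All five checks are decided by the kernel in consumers.
* `grid24Lo`, `grid24Hi`, `xl24`, `xh24`, `gridEncl24` — a rational table enclosing `sin²(iπ/48)`, `i = 0..24`,
  to `±3·10⁻⁷`, CERTIFIED against `FI.cosSin`/`FI.pi` (`gridEnclCheck`, `decide +kernel`, ≈ 7 s).

Consumer: `EmeryFermiFillingLa214`. Sources: [HybertsenSchluterChristensen1989, Eq. (1)]; [AndersenEtAl1995, §6].
-/

noncomputable section

namespace Summit.Ventures.CertifiedManyBodySolver.Downfold.Emery

open Real Set

/-! ## The sub-box rule -/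

/-- Rational side conditions of a sub-box certificate (see `fsRatio_window_of_checks`). [folklore] -/
def subBoxCheck (Δ₁ Δ₂ a₁ a₂ b₁ b₂ c₁ c₂ e₁ e₂ Ahi Dlo Nlo Alo Dhi Nhi : ℚ) : Bool :=
  decide (0 < a₁) && decide (a₁ ≤ a₂) && decide (0 ≤ c₁) && decide (c₁ ≤ c₂) && decide (c₂ < b₁) &&
  decide (b₁ ≤ b₂) && decide (0 < Δ₁) && decide (Δ₁ ≤ Δ₂) && decide (0 ≤ e₁) && decide (e₁ ≤ e₂) &&
  decide (2 * c₂ * e₂ ≤ a₁ ^ 2) &&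
  decide (e₁ * (Δ₂ + e₁) ^ 2 ≤ Ahi) && decide (Dlo ≤ (Δ₁ + e₁) * (a₁ ^ 2 - c₂ * e₁)) &&
  decide (Nlo ≤ (c₁ + b₁) * (2 * a₁ ^ 2 + e₁ * (b₁ - c₂))) && decide (0 ≤ Dlo) && decide (0 ≤ Nlo) &&
  decide (Alo ≤ e₂ * (Δ₁ + e₂) ^ 2) && decide ((Δ₂ + e₂) * (a₂ ^ 2 - c₁ * e₂) ≤ Dhi) &&
  decide ((c₂ + b₂) * (2 * a₂ ^ 2 + e₂ * (b₂ - c₁)) ≤ Nhi) && decide (0 ≤ Dhi) && decide (0 ≤ Nhi)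

/-- **THE SUB-BOX RULE.** On a parameter sub-box passing `subBoxCheck`, an outer count below `ν₁` at `e₁`, an
inner count above `ν₂` at `e₂` (`EmeryFermiFillingCount`) and two corner `ratioCheck`s
(`EmeryFermiSurfaceRatioWindow`) certify: for every parameter point of the sub-box and every Fermi energy `ε`
whose filling `abFilling(ε)` lies in `[ν₁, ν₂]`, (i) `ε ∈ [e₁, e₂]` and (ii) the Fermi-surface `t′/t` lies in
`[lo, hi]`. [folklore] -/
theorem fsRatio_window_of_checks {K : ℕ} (hK : 0 < K) {xl xh : ℕ → ℚ} (hG : GridEncl K xl xh)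
    {Δ₁ Δ₂ a₁ a₂ b₁ b₂ c₁ c₂ e₁ e₂ Ahi Dlo Nlo Alo Dhi Nhi lo hi ν₁ ν₂ : ℚ} {m : ℕ}
    (hchk : subBoxCheck Δ₁ Δ₂ a₁ a₂ b₁ b₂ c₁ c₂ e₁ e₂ Ahi Dlo Nlo Alo Dhi Nhi = true)
    (hOut : ((outerFlagged K xl Ahi Dlo Nlo).card : ℚ) / (K : ℚ) ^ 2 < ν₁)
    (hIn : ν₂ < ((innerFlagged K xh e₂ Alo Dhi Nhi Δ₁ (a₂ ^ 2) (b₂ ^ 2)).card : ℚ) / (K : ℚ) ^ 2)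
    (hRlo : ratioCheck Δ₁ a₁ b₂ c₂ e₁ e₂ m lo 0 = true)
    (hRhi : ratioCheck Δ₂ a₂ b₁ c₁ e₁ e₂ m (-1) hi = true)
    {Δ tpd tpp c ε : ℝ} (hΔ : Δ ∈ Set.Icc (Δ₁ : ℝ) Δ₂) (ha : tpd ∈ Set.Icc (a₁ : ℝ) a₂)
    (hb : tpp ∈ Set.Icc (b₁ : ℝ) b₂) (hc : c ∈ Set.Icc (c₁ : ℝ) c₂)
    (hν : abFilling Δ tpd tpp c ε ∈ Set.Icc (ν₁ : ℝ) ν₂) :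
    ε ∈ Set.Icc (e₁ : ℝ) e₂ ∧ fsRatio Δ tpd tpp c ε ∈ Set.Icc (lo : ℝ) hi := by
  simp only [subBoxCheck, Bool.and_eq_true, decide_eq_true_eq] at hchk
  obtain ⟨⟨⟨⟨⟨⟨⟨⟨⟨⟨⟨⟨⟨⟨⟨⟨⟨⟨⟨⟨qa₁, qa⟩, qc₁⟩, qc⟩, qcb⟩, qb⟩, qΔ₁⟩, qΔ⟩, qe₁⟩, qe⟩, qcap⟩,
    qAhi⟩, qDlo⟩, qNlo⟩, qDlo0⟩, qNlo0⟩, qAlo⟩, qDhi⟩, qNhi⟩, qDhi0⟩, qNhi0⟩ := hchk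
  obtain ⟨hΔlo, hΔhi⟩ := hΔ
  obtain ⟨halo, hahi⟩ := ha
  obtain ⟨hblo, hbhi⟩ := hb
  obtain ⟨hclo, hchi⟩ := hc
  -- real casts of the rational facts
  have ra₁ : (0 : ℝ) < a₁ := by exact_mod_cast qa₁
  have rc₁ : (0 : ℝ) ≤ c₁ := by exact_mod_cast qc₁
  have rcb : (c₂ : ℝ) < b₁ := by exact_mod_cast qcb
  have rΔ₁ : (0 : ℝ) < Δ₁ := by exact_mod_cast qΔ₁
  have re₁ : (0 : ℝ) ≤ e₁ := by exact_mod_cast qe₁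
  have re : (e₁ : ℝ) ≤ e₂ := by exact_mod_cast qe
  have rcap : 2 * (c₂ : ℝ) * e₂ ≤ (a₁ : ℝ) ^ 2 := by exact_mod_cast qcap
  have hc0 : 0 ≤ c := rc₁.trans hclo
  have hc₂0 : (0 : ℝ) ≤ c₂ := hc0.trans hchi
  have htpd : 0 < tpd := lt_of_lt_of_le ra₁ halo
  have hb₁0 : (0 : ℝ) ≤ b₁ := hc₂0.trans rcb.le
  have re₂ : (0 : ℝ) ≤ e₂ := re₁.trans re
  have hcap₁ : (c₂ : ℝ) * e₁ ≤ (a₁ : ℝ) ^ 2 := by nlinarith [mul_nonneg hc₂0 re₁]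
  have hcap₂ : (c₂ : ℝ) * e₂ ≤ (a₁ : ℝ) ^ 2 := by nlinarith [mul_nonneg hc₂0 re₂]
  -- OUTER bound at e₁
  have hOutR : abFilling Δ tpd tpp c e₁ ≤ ((outerFlagged K xl Ahi Dlo Nlo).card : ℝ) / (K : ℝ) ^ 2 := by
    refine abFilling_le_card_outerFlagged hK hG ?_ ?_ ?_ qDlo0 qNlo0
    · -- cA Δ e₁ ≤ Ahi
      have h1 : (Δ + e₁) ^ 2 ≤ ((Δ₂ : ℝ) + e₁) ^ 2 :=
        pow_le_pow_left₀ (by linarith) (by linarith) 2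
      have h2 : (e₁ : ℝ) * ((Δ₂ : ℝ) + e₁) ^ 2 ≤ Ahi := by exact_mod_cast qAhi
      unfold cA
      nlinarith [mul_le_mul_of_nonneg_left h1 re₁]
    · have hD := (fsD_mem_Icc (Δ := Δ) (tpd := tpd) (c := c) (ε := (e₁ : ℝ)) ra₁.le rc₁ re₁ (by linarith)
        hcap₁ ⟨hΔlo, hΔhi⟩ ⟨halo, hahi⟩ ⟨hclo, hchi⟩ ⟨le_rfl, le_rfl⟩).1
      have h2 : (Dlo : ℝ) ≤ ((Δ₁ : ℝ) + e₁) * ((a₁ : ℝ) ^ 2 - c₂ * e₁) := by exact_mod_cast qDlo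
      exact h2.trans hD
    · have hN := (fsN_mem_Icc (tpd := tpd) (tpp := tpp) (c := c) (ε := (e₁ : ℝ)) ra₁.le hb₁0 rc₁ re₁
        hcap₁ ⟨halo, hahi⟩ ⟨hblo, hbhi⟩ ⟨hclo, hchi⟩ ⟨le_rfl, le_rfl⟩).1
      rw [min_self] at hN
      have h2 : (Nlo : ℝ) ≤ ((c₁ : ℝ) + b₁) * (2 * (a₁ : ℝ) ^ 2 + e₁ * (b₁ - c₂)) := by exact_mod_cast qNlo
      exact h2.trans hN
  -- INNER bound at e₂
  have hInR : ((innerFlagged K xh e₂ Alo Dhi Nhi Δ₁ (a₂ ^ 2) (b₂ ^ 2)).card : ℝ) / (K : ℝ) ^ 2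
      ≤ abFilling Δ tpd tpp c e₂ := by
    refine card_innerFlagged_le_abFilling hK hG ?_ ?_ ?_ qDhi0 qNhi0 hΔlo qΔ₁.le hc0 ?_ ?_ (qe₁.trans qe)
    · have h1 : ((Δ₁ : ℝ) + e₂) ^ 2 ≤ (Δ + e₂) ^ 2 :=
        pow_le_pow_left₀ (by linarith) (by linarith) 2
      have h2 : (Alo : ℝ) ≤ (e₂ : ℝ) * ((Δ₁ : ℝ) + e₂) ^ 2 := by exact_mod_cast qAlo
      unfold cA
      nlinarith [mul_le_mul_of_nonneg_left h1 re₂]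
    · have hD := (fsD_mem_Icc (Δ := Δ) (tpd := tpd) (c := c) (ε := (e₂ : ℝ)) ra₁.le rc₁ re₂ (by linarith)
        hcap₂ ⟨hΔlo, hΔhi⟩ ⟨halo, hahi⟩ ⟨hclo, hchi⟩ ⟨le_rfl, le_rfl⟩).2
      have h2 : ((Δ₂ : ℝ) + e₂) * ((a₂ : ℝ) ^ 2 - c₁ * e₂) ≤ Dhi := by exact_mod_cast qDhi
      exact hD.trans h2
    · have hN := (fsN_mem_Icc (tpd := tpd) (tpp := tpp) (c := c) (ε := (e₂ : ℝ)) ra₁.le hb₁0 rc₁ re₂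
        hcap₂ ⟨halo, hahi⟩ ⟨hblo, hbhi⟩ ⟨hclo, hchi⟩ ⟨le_rfl, le_rfl⟩).2
      rw [max_self] at hN
      have h2 : ((c₂ : ℝ) + b₂) * (2 * (a₂ : ℝ) ^ 2 + e₂ * (b₂ - c₁)) ≤ Nhi := by exact_mod_cast qNhi
      exact hN.trans h2
    · push_cast; exact pow_le_pow_left₀ htpd.le hahi 2
    · push_cast; exact pow_le_pow_left₀ (hb₁0.trans hblo) hbhi 2
  -- the bracket
  have hOut' : ((outerFlagged K xl Ahi Dlo Nlo).card : ℝ) / (K : ℝ) ^ 2 < ν₁ := by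
    have := (Rat.cast_lt (K := ℝ)).2 hOut
    push_cast at this
    exact this
  have hIn' : (ν₂ : ℝ) < ((innerFlagged K xh e₂ Alo Dhi Nhi Δ₁ (a₂ ^ 2) (b₂ ^ 2)).card : ℝ) / (K : ℝ) ^ 2 := by
    have := (Rat.cast_lt (K := ℝ)).2 hIn
    push_cast at this
    exact this
  have hε : ε ∈ Set.Icc (e₁ : ℝ) e₂ := fermiEnergy_mem_Icc_of_abFilling_mem hOutR hOut' hInR hIn' hν
  refine ⟨hε, ?_⟩
  -- corners + ratio checks
  have hε0 : 0 ≤ ε := re₁.trans hε.1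
  have hcb := fsRatio_corner_bounds ra₁ rc₁ rcb hε0 (by linarith [hε.1]) (by nlinarith [hε.2, mul_nonneg hc₂0 hε0])
    ⟨hΔlo, hΔhi⟩ ⟨halo, hahi⟩ ⟨hblo, hbhi⟩ ⟨hclo, hchi⟩
  have hlo := (fsRatio_mem_of_ratioCheck hRlo hε).1
  have hhi := (fsRatio_mem_of_ratioCheck hRhi hε).2
  exact ⟨hlo.trans hcb.1, hcb.2.trans hhi⟩

/-! ## The certified `K = 24` grid table -/

/-- Lower rational table for `sin²(iπ/48)`, `i = 0, …, 24` (denominator `10⁷`, outward-rounded). [folklore] -/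
def grid24Lo : List ℚ := [0, 42773/10000000, 1331/78125, 1903/50000, 66987/1000000, 1033231/10000000, 91529/625000, 195619/1000000, 2499997/10000000, 154329/500000, 1852951/5000000, 4347367/10000000, 4999997/10000000, 1413157/2500000, 6294093/10000000, 1382683/2000000, 7499997/10000000, 1608761/2000000, 8535531/10000000, 2241691/2500000, 74641/80000, 1923879/2000000, 9829627/10000000, 4978611/5000000, 4999999/5000000]

/-- Upper rational table for `sin²(iπ/48)`, `i = 0, …, 24`. [folklore] -/
def grid24Hi : List ℚ := [1/5000000, 21389/5000000, 170373/10000000, 76121/2000000, 5359/80000, 258309/2500000, 1464469/10000000, 391239/2000000, 1250001/5000000, 617317/2000000, 3705907/10000000, 1086843/2500000, 2500001/5000000, 5652633/10000000, 3147049/5000000, 345671/500000, 3750001/5000000, 804381/1000000, 533471/625000, 8966769/10000000, 933013/1000000, 48097/50000, 76794/78125, 9957227/10000000, 1]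

/-- The lower table as a function (default `0` beyond the table). [folklore] -/
def xl24 (i : ℕ) : ℚ := grid24Lo.getD i 0

/-- The upper table as a function (default `1` beyond the table). [folklore] -/
def xh24 (i : ℕ) : ℚ := grid24Hi.getD i 1

/-- **The `K = 24` table encloses `sin²(k_i/2)`** — certified against `FI.cosSin` / `FI.pi` by the kernel.
[folklore] -/
theorem gridEncl24 : GridEncl 24 xl24 xh24 :=
  gridEncl_of_check (by norm_num) (by decide +kernel)

end Summit.Ventures.CertifiedManyBodySolver.Downfold.Emery
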